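import Literature.AlgebraicGeometry.Frobenioids.PadicFieldwiseSaturatedOfEquivalence
import HarnessLib

/-!
# Frobenioids II, Theorem 2.4 (i) over GENERAL bases from an equivalence `Ψ : C₁ ⥲ C₂` ALONE, with the clause
# «`Φ₁` is fieldwise saturated if and only if `Φ₂` is» PROVED (the hypothesis `hfs` DISCHARGED) — modulo map_H only

Mochizuki, *The geometry of Frobenioids II*, Kyushu J. Math. **62** (2008) 401–460, §2, Theorem 2.4 (i) pp. 19–20
[cite: MochizukiFrdII2008, Thm 2.4 (i) p.19]: "Assume that this isomorphism `G₁ ⥲ G₂` maps `H₁` onto `H₂`. Then … (i) `Φ₁`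
is fieldwise saturated if and only if `Φ₂` is. Moreover, `p₁ = p₂`; `Ψ` maps `(N, H₁)`-saturated objects to `(N, H₂)`-saturated
objects and induces isomorphisms … which are compatible with the respective Kummer and reciprocity maps".

PROOF-ONLY knit (cell abc-iut, layer L1, seat abc-iut-L1-t10 gen 9; row «HFS-FROM-Ψ», L1-lead GO-2 2026-08-26T13:23Z) of
abc-iut-L1-t7's assembly `PadicKummer.Def22Context.thm24i_ofEquivalenceRel` (`PadicKummerThm24iFrobenioidRelOfEquivalence.lean`:
Theorem 2.4 (i) for the `pᵢ`-adic Frobenioids over `Dᵢ = B^temp(Πᵢ, Πᵢ°)⁰` from an EQUIVALENCE `Ψ` modulo {map_H, hfs}) with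
this seat's `PadicFrd.Datum.isFieldwiseSaturated_iff_of_equivalence_temperedBase` (`PadicFieldwiseSaturatedOfEquivalence.lean`)
at the binding `fsᵢ := dᵢ.IsFieldwiseSaturated`:
* **`thm24i_ofEquivalenceRel_hfs`** — the typed `Thm24i` for the Definition 2.2 contexts of `A₁`, `Ψ A₁` with its FIRST
  conjunct the genuine «`Φ₁` is fieldwise saturated ⟺ `Φ₂` is fieldwise saturated», from `Ψ` and print's standing
  hypotheses (`Πᵢ` temp-slim tempered, `Π₁` Galois-countable, `Πᵢ → G_{ℚ_{pᵢ}}` open homomorphisms) modulo EXACTLY the printed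
  ASSUMPTION map_H ("this isomorphism `G₁ ⥲ G₂` maps `H₁` onto `H₂`", for the chosen representative) — plus the object-level
  side data of the typed schema (`(A₁)_D`, `(Ψ A₁)_D` Galois, `μ_N(K̄ᵢ) ⊆ Lᵢ`, a normalisation `F_N(A₁) ≅ ℤ/N`, `(N, H₁)`-saturation).
No definitions; nothing here bears on [IUTchIII] Cor. 3.12; no statement of the paper is strengthened.
-/

noncomputable section

namespace Literature.AlgebraicGeometry.Frobenioids

namespace PadicKummer.Def22Context

open CategoryTheory Field IntermediateField Kummer Function
open Literature.NumberTheory.GaloisRepresentations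
open Literature.AnabelianGeometry.SemiGraphs QuasiTemperoid PadicFrd PadicFrd.Datum PadicFrd.Datum.GaloisChart PadicFrd.RelGal

variable {p₁ p₂ : ℕ} [Fact p₁.Prime] [Fact p₂.Prime]
  {P₁ : Type} [Group P₁] [TopologicalSpace P₁] [IsTopologicalGroup P₁] [SecondCountableTopology P₁] (hP₁ : IsTempered P₁)
  (hZ₁ : IsSlimGroup P₁) {φ₁ : P₁ →* GalFbar ℚ_[p₁]} {hφ₁ : IsOpenHom φ₁} {P₁₀ : OpenSubgroup P₁}
  {d₁ : PadicFrd.Datum (RelCosetCat P₁₀) p₁} (hd₁ : d₁.base = relBaseGal p₁ P₁₀ φ₁ hφ₁)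
  {P₂ : Type} [Group P₂] [TopologicalSpace P₂] [IsTopologicalGroup P₂] (hP₂ : IsTempered P₂) (hZ₂ : IsSlimGroup P₂)
  {φ₂ : P₂ →* GalFbar ℚ_[p₂]} {hφ₂ : IsOpenHom φ₂} {P₂₀ : OpenSubgroup P₂}
  {d₂ : PadicFrd.Datum (RelCosetCat P₂₀) p₂} (hd₂ : d₂.base = relBaseGal p₂ P₂₀ φ₂ hφ₂)
  (Ψ : d₁.frobenioid ≌ d₂.frobenioid)
  {A₁ : d₁.frobenioid} (hA₁ : A₁.base.obj.sg.toSubgroup.Normal) (hA₂ : (Ψ.functor.obj A₁).base.obj.sg.toSubgroup.Normal)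
  {H₁ : Subgroup (absoluteGaloisGroup (baseFld p₁ φ₁ hφ₁))} [H₁.Normal]
  {hH₁ : IsOpen (H₁ : Set (absoluteGaloisGroup (baseFld p₁ φ₁ hφ₁)))}
  {H₂ : Subgroup (absoluteGaloisGroup (baseFld p₂ φ₂ hφ₂))} [H₂.Normal]
  {hH₂ : IsOpen (H₂ : Set (absoluteGaloisGroup (baseFld p₂ φ₂ hφ₂)))}
  (map_H : H₁.map (isoGOfTheta φ₁ hφ₁ φ₂ hφ₂ Ψ.functor
    (thetaOfBase hP₁ hP₂ Ψ.functor (baseEquivalenceOf hP₁ hZ₁ hP₂ hZ₂ Ψ) (baseEquivalenceIso hP₁ hZ₁ hP₂ hZ₂ Ψ))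
    (continuous_thetaOfBase hP₁ hP₂ Ψ.functor (baseEquivalenceOf hP₁ hZ₁ hP₂ hZ₂ Ψ) (baseEquivalenceIso hP₁ hZ₁ hP₂ hZ₂ Ψ))
    (isOpenMap_thetaOfBase hP₁ hP₂ Ψ.functor (baseEquivalenceOf hP₁ hZ₁ hP₂ hZ₂ Ψ) (baseEquivalenceIso hP₁ hZ₁ hP₂ hZ₂ Ψ))
    (bijective_thetaOfBase hP₁ hP₂ Ψ.functor (baseEquivalenceOf hP₁ hZ₁ hP₂ hZ₂ Ψ) (baseEquivalenceIso hP₁ hZ₁ hP₂ hZ₂ Ψ)).2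
    (hker_thetaOfBase hP₁ φ₁ hφ₁ hd₁ hP₂ φ₂ hφ₂ hd₂ Ψ.functor (baseEquivalenceOf hP₁ hZ₁ hP₂ hZ₂ Ψ)
      (baseEquivalenceIso hP₁ hZ₁ hP₂ hZ₂ Ψ) (map_mem_endSubmonoid_iff hP₁ hZ₁ hP₂ hZ₂ Ψ))
    (baseIsoOfPush Ψ.functor
      (thetaOfBase hP₁ hP₂ Ψ.functor (baseEquivalenceOf hP₁ hZ₁ hP₂ hZ₂ Ψ) (baseEquivalenceIso hP₁ hZ₁ hP₂ hZ₂ Ψ))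
      (isOpenMap_thetaOfBase hP₁ hP₂ Ψ.functor (baseEquivalenceOf hP₁ hZ₁ hP₂ hZ₂ Ψ) (baseEquivalenceIso hP₁ hZ₁ hP₂ hZ₂ Ψ))
      (basePushIsoOfBase hP₁ hP₂ Ψ.functor (baseEquivalenceOf hP₁ hZ₁ hP₂ hZ₂ Ψ) (baseEquivalenceIso hP₁ hZ₁ hP₂ hZ₂ Ψ))
      A₁)).toMulEquiv.toMonoidHom = H₂)
  (N : ℕ) [NeZero N]
  (hμ₁ : ∀ ζ : rootsOfUnity N (AlgebraicClosure (baseFld p₁ φ₁ hφ₁)),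
    ((ζ : (AlgebraicClosure (baseFld p₁ φ₁ hφ₁))ˣ) : AlgebraicClosure (baseFld p₁ φ₁ hφ₁)) ∈ objL φ₁ hφ₁ d₁ A₁)
  (hμ₂ : ∀ ζ : rootsOfUnity N (AlgebraicClosure (baseFld p₂ φ₂ hφ₂)),
    ((ζ : (AlgebraicClosure (baseFld p₂ φ₂ hφ₂))ˣ) : AlgebraicClosure (baseFld p₂ φ₂ hφ₂)) ∈
      objL φ₂ hφ₂ d₂ (Ψ.functor.obj A₁))

/-- **[FrdII] Theorem 2.4 (i) for the `p`-adic Frobenioids over GENERAL bases `Dᵢ = B^temp(Πᵢ, Πᵢ°)⁰` from an EQUIVALENCE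
`Ψ : C₁ ⥲ C₂` and print's standing hypotheses, with the clause «`Φ₁` is fieldwise saturated if and only if `Φ₂` is» a
THEOREM (`fsᵢ := dᵢ.IsFieldwiseSaturated`, `hfs := isFieldwiseSaturated_iff_of_equivalence_temperedBase`) — modulo EXACTLY
the printed ASSUMPTION map_H ("this isomorphism `G₁ ⥲ G₂` maps `H₁` onto `H₂`", for the chosen representative).**  For `A₁` with
`(A₁)_D`, `(Ψ A₁)_D` Galois, `μ_N(K̄ᵢ) ⊆ Lᵢ`, `A₁` `(N, H₁)`-saturated and any normalisation `F_N(A₁) ≅ ℤ/N`, the typed `Thm24i`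
holds for the contexts of `A₁`, `Ψ A₁`, the comparison data induced by `Ψ` and the cup-product duality isomorphisms; every
structural input of abc-iut-L1-t7's chain (`Ψ_Base`, `η`, hO, `θ`, hkerθ, `isoG`, …) and now also hfs ([FrdI] Cor. 4.10 /
4.11 (ii)(iii) + Thm. 5.2 (ii) transport of `(Φ, B, Div_B)`, abc-iut-w5-d229's transport of (a), (b)) is a THEOREM.
[cite: MochizukiFrdII2008, Thm 2.4 (i) p.19] -/
theorem thm24i_ofEquivalenceRel_hfs
    (eFN₁ : FN (contextOfObjectRel φ₁ hφ₁ d₁ hd₁ A₁ hA₁ H₁ hH₁) N ≃+ ZMod N)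
    (hc₁ : IsNHSaturated (contextOfObjectRel φ₁ hφ₁ d₁ hd₁ A₁ hA₁ H₁ hH₁) N) :
    haveI := finiteDimensional_objL φ₁ hφ₁ d₁ A₁; haveI := normal_objL φ₁ hφ₁ d₁ A₁ hA₁
    haveI := finiteDimensional_objL φ₂ hφ₂ d₂ (Ψ.functor.obj A₁)
    haveI := normal_objL φ₂ hφ₂ d₂ (Ψ.functor.obj A₁) hA₂
    haveI := finiteDimensional_baseFld p₁ φ₁ hφ₁; haveI := finiteDimensional_baseFld p₂ φ₂ hφ₂
    haveI := locallyCompactSpace_H_contextOfObjectRel φ₁ hφ₁ d₁ hd₁ A₁ hA₁ H₁ hH₁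
    haveI := locallyCompactSpace_H_contextOfObjectRel φ₂ hφ₂ d₂ hd₂ (Ψ.functor.obj A₁) hA₂ H₂ hH₂
    letI := (galoisChartRel φ₁ hφ₁ d₁ hd₁ A₁ hA₁).galAction
    letI := (galoisChartRel φ₂ hφ₂ d₂ hd₂ (Ψ.functor.obj A₁) hA₂).galAction
    Thm24i (contextOfObjectRel φ₁ hφ₁ d₁ hd₁ A₁ hA₁ H₁ hH₁)
      (contextOfObjectRel φ₂ hφ₂ d₂ hd₂ (Ψ.functor.obj A₁) hA₂ H₂ hH₂) N p₁ p₂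
      d₁.IsFieldwiseSaturated d₂.IsFieldwiseSaturated
      ((isoOfEquivalenceRel hP₁ hZ₁ hd₁ hP₂ hZ₂ hd₂ Ψ hA₁ hA₂ map_H).thm24Data N)
      ((contextOfObjectRel φ₁ hφ₁ d₁ hd₁ A₁ hA₁ H₁ hH₁).dualityIsoOfLocalDuality N eFN₁ hc₁
        (cupDualH_bijective_ofGalois_mlf p₁ (objL φ₁ hφ₁ d₁ A₁) H₁ hH₁ (galoisChartRel φ₁ hφ₁ d₁ hd₁ A₁ hA₁).res
          (galoisChartRel φ₁ hφ₁ d₁ hd₁ A₁ hA₁).res_smul ((galoisChartRel φ₁ hφ₁ d₁ hd₁ A₁ hA₁).muModel N hμ₁)))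
      ((contextOfObjectRel φ₂ hφ₂ d₂ hd₂ (Ψ.functor.obj A₁) hA₂ H₂ hH₂).dualityIsoOfLocalDuality N
        (((isoOfEquivalenceRel hP₁ hZ₁ hd₁ hP₂ hZ₂ hd₂ Ψ hA₁ hA₂ map_H).isoFN N).symm.trans eFN₁)
        (((isoOfEquivalenceRel hP₁ hZ₁ hd₁ hP₂ hZ₂ hd₂ Ψ hA₁ hA₂ map_H).isNHSaturated_iff N).mp hc₁)
        (cupDualH_bijective_ofGalois_mlf p₂ (objL φ₂ hφ₂ d₂ (Ψ.functor.obj A₁)) H₂ hH₂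
          (galoisChartRel φ₂ hφ₂ d₂ hd₂ (Ψ.functor.obj A₁) hA₂).res
          (galoisChartRel φ₂ hφ₂ d₂ hd₂ (Ψ.functor.obj A₁) hA₂).res_smul
          ((galoisChartRel φ₂ hφ₂ d₂ hd₂ (Ψ.functor.obj A₁) hA₂).muModel N hμ₂))) :=
  thm24i_ofEquivalenceRel hP₁ hZ₁ hd₁ hP₂ hZ₂ hd₂ Ψ hA₁ hA₂ map_H N hμ₁ hμ₂
    d₁.IsFieldwiseSaturated d₂.IsFieldwiseSaturated
    (isFieldwiseSaturated_iff_of_equivalence_temperedBase hP₁ hZ₁ hφ₁ hd₁ hP₂ hZ₂ hφ₂ hd₂ Ψ) eFN₁ hc₁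

end PadicKummer.Def22Context

end Literature.AlgebraicGeometry.Frobenioids

end
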